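import Summits.AtomisticToContinuum.HydrodynamicLimit.Theorems.RelayRaceLocalityNearConstantShortTimeHLGeneralFamilyLDA
import Summits.AtomisticToContinuum.HydrodynamicLimit.Theorems.RelayRaceLocalityNearConstantShortTimeHLGeneralFamilyConcentration
import Summits.AtomisticToContinuum.HydrodynamicLimit.Theorems.RelayRaceLocalityNearConstantShortTimeHLMeansPinEquivalence
import HarnessLib

/-!
# Crux `NearConstantShortTimeHL` (stmt-AtomisticToContinuum-12502), line `small-tilt-domination` — the dock (v1 stub S6)

Support file (`--supports stmt-AtomisticToContinuum-12502`): the registered stub `stub_meansToRelEntropy : MeansConverge →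
NearConstantRelEntropy` of the line `small-tilt-domination` (skeleton `Cruxes/NearConstantShortTimeHL/Lines/small_tilt_domination.lean`),
now a corollary of the tree: `nearConstantRelEntropy_of_meansConverge` (line `means-pin-entropy`: the pin at the Euler-matched reference +
the engine bridge, `…MeansPinEquivalence.lean`) with its two statics inputs discharged by the landed general-family theorems
`stub_ldaGeneralFamilies` (`…GeneralFamilyLDA.lean`) and `stub_concentrationGeneralFamilies` (`…GeneralFamilyConcentration.lean`).
No new mathematics — composition only. Reference: H.-T. Yau, Lett. Math. Phys. 22 (1991) §2.
-/

noncomputable section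

namespace Summit.AtomisticToContinuum.HydrodynamicLimit.Theorems.NearConstantShortTimeHL

/-- **S6 — THE DOCK of line `small-tilt-domination`** (registered stub `stub_meansToRelEntropy`): convergence of the means at `t`
implies the Yau-form target `NearConstantRelEntropy`, unconditionally — `nearConstantRelEntropy_of_meansConverge` fed by the landed
statics `stub_ldaGeneralFamilies` (LDA, general families) and `stub_concentrationGeneralFamilies` (exponential concentration, general
families). With `stub_entropyToLLN` (landed) the crux is therefore EQUIVALENT to `MeansConverge`. [cite: Yau1991, §2] -/
theorem stub_meansToRelEntropy : MeansConverge → NearConstantRelEntropy :=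
  nearConstantRelEntropy_of_meansConverge stub_ldaGeneralFamilies stub_concentrationGeneralFamilies

end Summit.AtomisticToContinuum.HydrodynamicLimit.Theorems.NearConstantShortTimeHL

end
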